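import Summits.ValiantsHypothesis.ValiantsHypothesis.Theorems.KPlusLogSqLawTropicalOrbitExchange

/-!
# Tropical census, symmetric designs — orbit-model rules S and M, the weak comparison, and the one-vs-two exchange with a weak comparison

HONEST FRAMING.  Helper file (seat typer (g11), cell `pub-symmetroid`, 2026-08-27; `--supports` the `WeakLifting` item
stmt-ValiantsHypothesis-19561 as a helper, no closure claim; desk R1631 / R1640 (3)).  Pure lemma file in the transpose-ORBIT carrier
model (`…TropicalOrbitDominance`, `…TropicalOrbitExchange`): general format `(m, K)`, integer slopes, no sweep object, no strictness, no
adjacency.  It supplies what the `m = 3` pair-carrier rules (R2w / R2′w / R3w / R3′w, file `…TropicalOrbitRulesThree`) consume: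
* `tropWeight_le_of_isOrbitDominant` — an orbit-dominant term of a design with SYMMETRIC valuations weakly beats every present term
  (its own orbit ties with it, `tropWeight_transpose`); `isOrbitDominant_transpose` — the transposed term is orbit-dominant too;
* `orbit_exchange₂_le` / `orbit_exchange₂'_le` — the one-vs-two exchange of `…OrbitExchange` with ONE of the two comparisons at the
  doubled slope only WEAK (the hybrid may lie in the orbit; arithmetic cores `affine_cross₂_le`, `affine_cross₂'_le`) — the shape of
  R2w / R2′w;
* `rule_S_orbit` — SLOPE INCREASE: orbit-dominant terms from different orbits at `θ₁ < θ₂` have `e(P) < e(Q)` (`orbit_exchange` with the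
  trivial hybrid pair `(Q, P)`);
* `rule_M_orbit` — MONOTONE SHARED LETTER: two orbit-dominant terms reading the same cell (or transposed cells) with different letters
  `x` at `θ₁` and `y` at `θ₂ > θ₁`, whose two letter swaps are present and outside the respective orbits, have `d x < d y`
  (bookkeeping `sum_apply_replace`).
Nothing here is a census numeral: tropical objects bound no real pencil; ζ_sym(3,4) ∈ {18,19}, the kernel single-term `(3,4)` window
`[15, 18]`, DoorA34 = `PosRootLawAt 3 4 18` (stmt-ValiantsHypothesis-19980) and DoorA26 (stmt-19979) are untouched (OPEN, typed, never
asserted); nothing on `TropicalB` / `WeakLifting` as closed, on `MatrixDescartes` (stmt-ValiantsHypothesis-18050) or on `VP ≠ VNP`.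
[folklore] (linear exchange arguments).
-/

-- `Summit.ValiantsHypothesis.ValiantsHypothesis.…` is the tree's mandated single-conjunct layout (Sub = Summit).
set_option linter.dupNamespace false
set_option autoImplicit false

namespace Summit.ValiantsHypothesis.ValiantsHypothesis.Theorems.LacunarySymmetroidMatrixDescartes.TropicalCensus.Orbit

open Summit.ValiantsHypothesis.ValiantsHypothesis.Theorems.MatrixDescartes.Negative
open Summit.ValiantsHypothesis.ValiantsHypothesis.Theorems.LacunarySymmetroidMatrixDescartes
open Summit.ValiantsHypothesis.ValiantsHypothesis.Theorems.LacunarySymmetroidMatrixDescartes.TropicalCensus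
open scoped BigOperators

variable {m K : ℕ}

/-! ## Weak comparison and transpose -/

/-- An orbit-dominant term of a SYMMETRIC-valuation design weakly beats every present term (its own orbit ties with it). [folklore] -/
theorem tropWeight_le_of_isOrbitDominant (d : Fin K → ℕ) (v ε : Fin m → Fin m → Fin K → ℤ)
    (hv : ∀ i j l, v i j l = v j i l) {θ : ℤ} {Q : Equiv.Perm (Fin m) × (Fin m → Fin K)}
    (hQ : IsOrbitDominant d v ε θ Q) (H : Equiv.Perm (Fin m) × (Fin m → Fin K)) (hH : termSign ε H ≠ 0) :
    tropWeight d v θ H ≤ tropWeight d v θ Q := by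
  by_cases h1 : H = Q
  · rw [h1]
  by_cases h2 : H = transposeTerm Q
  · rw [h2]
    obtain ⟨σ, lam⟩ := Q
    exact (tropWeight_transpose d v hv θ σ lam).le
  · exact (hQ.2 H h1 h2 hH).le

/-- The transpose of an orbit-dominant term of a symmetric design is orbit-dominant (same orbit, same weight, same sign). [folklore] -/
theorem isOrbitDominant_transpose (d : Fin K → ℕ) (v ε : Fin m → Fin m → Fin K → ℤ)
    (hv : ∀ i j l, v i j l = v j i l) (hε : ∀ i j l, ε i j l = ε j i l) {θ : ℤ}
    (σ : Equiv.Perm (Fin m)) (lam : Fin m → Fin K) (h : IsOrbitDominant d v ε θ (σ, lam)) :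
    IsOrbitDominant d v ε θ (transposeTerm (σ, lam)) := by
  refine ⟨?_, fun p' h1 h2 hs => ?_⟩
  · simp only [transposeTerm]
    rw [termSign_transpose ε hε σ lam]
    exact h.1
  · simp only [transposeTerm]
    rw [tropWeight_transpose d v hv θ σ lam]
    refine h.2 p' ?_ h1 hs
    intro hp
    apply h2
    rw [hp]
    simp only [transposeTerm, inv_inv]
    congr 1
    funext j
    simp

/-! ## One-vs-two exchange with a weak comparison -/

/-- affine crossing, one strict comparison at `θ₁`; at `θ₂` one WEAK and one strict comparison, doubled bookkeeping. [folklore] -/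
theorem affine_cross₂_le {θ₁ θ₂ a a' a₁ a₂ a₃ c c' c₁ c₂ c₃ : ℤ} (hθ : θ₁ < θ₂) (ha : a + 2 * a' = a₁ + a₂ + a₃)
    (hc : c + 2 * c' = c₁ + c₂ + c₃) (h1 : θ₁ * a₁ - c₁ < θ₁ * a - c) (h2 : θ₂ * a₂ - c₂ ≤ θ₂ * a' - c')
    (h3 : θ₂ * a₃ - c₃ < θ₂ * a' - c') : a < a₁ := by
  have e1 : a₂ + a₃ = a + 2 * a' - a₁ := by omega
  have e2 : c₂ + c₃ = c + 2 * c' - c₁ := by omega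
  have hY : θ₂ * a - θ₂ * a₁ - c + c₁ < 0 := by
    have e3 : θ₂ * a₂ + θ₂ * a₃ = θ₂ * a + 2 * (θ₂ * a') - θ₂ * a₁ := by
      rw [← mul_add, e1]; ring
    linarith
  have hX : 0 < θ₁ * a - θ₁ * a₁ - c + c₁ := by linarith
  by_contra hcon
  push Not at hcon
  nlinarith [mul_nonneg (sub_nonneg.mpr hθ.le) (sub_nonneg.mpr hcon)]

/-- the mirror: at `θ₁` one WEAK and one strict comparison, at `θ₂` one strict comparison. [folklore] -/
theorem affine_cross₂'_le {θ₁ θ₂ a a' a₁ a₂ a₃ c c' c₁ c₂ c₃ : ℤ} (hθ : θ₁ < θ₂) (ha : a + 2 * a' = a₁ + a₂ + a₃)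
    (hc : c + 2 * c' = c₁ + c₂ + c₃) (h1 : θ₁ * a₂ - c₂ ≤ θ₁ * a' - c') (h2 : θ₁ * a₃ - c₃ < θ₁ * a' - c')
    (h3 : θ₂ * a₁ - c₁ < θ₂ * a - c) : a₁ < a := by
  have e1 : a₂ + a₃ = a + 2 * a' - a₁ := by omega
  have e2 : c₂ + c₃ = c + 2 * c' - c₁ := by omega
  have hY : θ₁ * a - θ₁ * a₁ - c + c₁ < 0 := by
    have e3 : θ₁ * a₂ + θ₁ * a₃ = θ₁ * a + 2 * (θ₁ * a') - θ₁ * a₁ := by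
      rw [← mul_add, e1]; ring
    linarith
  have hX : 0 < θ₂ * a - θ₂ * a₁ - c + c₁ := by linarith
  by_contra hcon
  push Not at hcon
  nlinarith [mul_nonneg (sub_nonneg.mpr hθ.le) (sub_nonneg.mpr hcon)]

/-- **ORBIT EXCHANGE, one-vs-two with a weak comparison** (symmetric valuations).  `P` orbit-dominant at `θ₁` beats the present
`H₁ ∉ {P, Pᵀ}`; `Q` orbit-dominant at `θ₂ > θ₁` weakly beats the present `H₂` (which may lie in its orbit) and strictly beats
`H₃ ∉ {Q, Qᵀ}`; doubled bookkeeping `e(P) + 2e(Q) = e(H₁) + e(H₂) + e(H₃)` (and heights) ⇒ `e(P) < e(H₁)`.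
(Shape of R2w: `P = T_p(b|a)`, `Q = C(c)`, `H₁ = H₂ = C(c; c_p ↦ b)`, `H₃ = T_p(c_p|a)`.) [folklore] -/
theorem orbit_exchange₂_le (d : Fin K → ℕ) (v ε : Fin m → Fin m → Fin K → ℤ) (hv : ∀ i j l, v i j l = v j i l)
    {θ₁ θ₂ : ℤ} (hθ : θ₁ < θ₂) (P Q H₁ H₂ H₃ : Equiv.Perm (Fin m) × (Fin m → Fin K))
    (hP : IsOrbitDominant d v ε θ₁ P) (hQ : IsOrbitDominant d v ε θ₂ Q)
    (h₁P : H₁ ≠ P) (h₁Pt : H₁ ≠ transposeTerm P) (hH₁ : termSign ε H₁ ≠ 0) (hH₂ : termSign ε H₂ ≠ 0)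
    (h₃Q : H₃ ≠ Q) (h₃Qt : H₃ ≠ transposeTerm Q) (hH₃ : termSign ε H₃ ≠ 0)
    (ha : ∑ l, (d (P.2 l) : ℤ) + 2 * ∑ l, (d (Q.2 l) : ℤ) =
      ∑ l, (d (H₁.2 l) : ℤ) + ∑ l, (d (H₂.2 l) : ℤ) + ∑ l, (d (H₃.2 l) : ℤ))
    (hc : ∑ l, v (P.1 l) l (P.2 l) + 2 * ∑ l, v (Q.1 l) l (Q.2 l) =
      ∑ l, v (H₁.1 l) l (H₁.2 l) + ∑ l, v (H₂.1 l) l (H₂.2 l) + ∑ l, v (H₃.1 l) l (H₃.2 l)) :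
    ∑ l, (d (P.2 l) : ℤ) < ∑ l, (d (H₁.2 l) : ℤ) := by
  have c1 := hP.2 H₁ h₁P h₁Pt hH₁
  have c2 := tropWeight_le_of_isOrbitDominant d v ε hv hQ H₂ hH₂
  have c3 := hQ.2 H₃ h₃Q h₃Qt hH₃
  simp only [tropWeight] at c1 c2 c3
  exact affine_cross₂_le hθ ha hc c1 c2 c3

/-- **ORBIT EXCHANGE, two-vs-one with a weak comparison (the mirror).**  `Q` orbit-dominant at `θ₁` weakly beats the present `H₂` and
strictly beats `H₃ ∉ {Q, Qᵀ}`; `P` orbit-dominant at `θ₂ > θ₁` beats the present `H₁ ∉ {P, Pᵀ}`; doubled bookkeeping ⇒ `e(H₁) < e(P)`.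
(Shape of R2′w.) [folklore] -/
theorem orbit_exchange₂'_le (d : Fin K → ℕ) (v ε : Fin m → Fin m → Fin K → ℤ) (hv : ∀ i j l, v i j l = v j i l)
    {θ₁ θ₂ : ℤ} (hθ : θ₁ < θ₂) (P Q H₁ H₂ H₃ : Equiv.Perm (Fin m) × (Fin m → Fin K))
    (hQ : IsOrbitDominant d v ε θ₁ Q) (hP : IsOrbitDominant d v ε θ₂ P)
    (h₁P : H₁ ≠ P) (h₁Pt : H₁ ≠ transposeTerm P) (hH₁ : termSign ε H₁ ≠ 0) (hH₂ : termSign ε H₂ ≠ 0)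
    (h₃Q : H₃ ≠ Q) (h₃Qt : H₃ ≠ transposeTerm Q) (hH₃ : termSign ε H₃ ≠ 0)
    (ha : ∑ l, (d (P.2 l) : ℤ) + 2 * ∑ l, (d (Q.2 l) : ℤ) =
      ∑ l, (d (H₁.2 l) : ℤ) + ∑ l, (d (H₂.2 l) : ℤ) + ∑ l, (d (H₃.2 l) : ℤ))
    (hc : ∑ l, v (P.1 l) l (P.2 l) + 2 * ∑ l, v (Q.1 l) l (Q.2 l) =
      ∑ l, v (H₁.1 l) l (H₁.2 l) + ∑ l, v (H₂.1 l) l (H₂.2 l) + ∑ l, v (H₃.1 l) l (H₃.2 l)) :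
    ∑ l, (d (H₁.2 l) : ℤ) < ∑ l, (d (P.2 l) : ℤ) := by
  have c1 := tropWeight_le_of_isOrbitDominant d v ε hv hQ H₂ hH₂
  have c2 := hQ.2 H₃ h₃Q h₃Qt hH₃
  have c3 := hP.2 H₁ h₁P h₁Pt hH₁
  simp only [tropWeight] at c1 c2 c3
  exact affine_cross₂'_le hθ ha hc c1 c2 c3

/-! ## Rule S (slope increase) in the orbit model -/

/-- **Rule S in the orbit model**: `P` orbit-dominant at `θ₁`, `Q` orbit-dominant at `θ₂ > θ₁`, the two orbits distinct ⇒
`e(P) < e(Q)` — `orbit_exchange` with the trivial hybrid pair `H₁ = Q`, `H₂ = P`. [folklore] -/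
theorem rule_S_orbit (d : Fin K → ℕ) (v ε : Fin m → Fin m → Fin K → ℤ) {θ₁ θ₂ : ℤ} (hθ : θ₁ < θ₂)
    (P Q : Equiv.Perm (Fin m) × (Fin m → Fin K))
    (hP : IsOrbitDominant d v ε θ₁ P) (hQ : IsOrbitDominant d v ε θ₂ Q)
    (hQP : Q ≠ P) (hQPt : Q ≠ transposeTerm P) (hPQ : P ≠ Q) (hPQt : P ≠ transposeTerm Q) :
    ∑ l, (d (P.2 l) : ℤ) < ∑ l, (d (Q.2 l) : ℤ) :=
  orbit_exchange d v ε hθ P Q Q P hP hQ hQP hQPt hQ.1 hPQ hPQt hP.1 (add_comm _ _) (add_comm _ _)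

/-! ## Rule M (monotone shared letter) in the orbit model -/

/-- replacing the letter in one column changes a column sum by the difference (bookkeeping). [folklore] -/
theorem sum_apply_replace (g : Fin m → Fin K → ℤ) (ξ : Fin m → Fin K) (l₁ : Fin m) (y : Fin K) :
    ∑ l, g l (if l = l₁ then y else ξ l) = ∑ l, g l (ξ l) + (g l₁ y - g l₁ (ξ l₁)) := by
  have h1 := Finset.add_sum_erase Finset.univ (fun l => g l (if l = l₁ then y else ξ l)) (Finset.mem_univ l₁)
  have h2 := Finset.add_sum_erase Finset.univ (fun l => g l (ξ l)) (Finset.mem_univ l₁)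
  have h3 : ∑ l ∈ Finset.univ.erase l₁, g l (if l = l₁ then y else ξ l) = ∑ l ∈ Finset.univ.erase l₁, g l (ξ l) :=
    Finset.sum_congr rfl fun l hl => by rw [if_neg (Finset.ne_of_mem_erase hl)]
  simp only [if_true] at h1
  linarith

/-- **Rule M in the orbit model** (monotone shared letter).  `X = (σ, ξ)` orbit-dominant at `θ₁` and `Y = (τ, υ)` orbit-dominant at
`θ₂ > θ₁` read the SAME cell — column `l₁` of `X` and column `l₂` of `Y` address the same cell, or transposed cells (equal heights by
symmetry) — with letters `x = ξ l₁ ≠ y = υ l₂`; if the two LETTER SWAPS `X[l₁ ↦ y]`, `Y[l₂ ↦ x]` are present and lie outside the orbits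
of `X` resp. `Y`, then `d x < d y`. [folklore] -/
theorem rule_M_orbit (d : Fin K → ℕ) (v ε : Fin m → Fin m → Fin K → ℤ) (hv : ∀ i j l, v i j l = v j i l)
    {θ₁ θ₂ : ℤ} (hθ : θ₁ < θ₂) (σ τ : Equiv.Perm (Fin m)) (ξ υ : Fin m → Fin K) (l₁ l₂ : Fin m)
    (hcell : (σ l₁ = τ l₂ ∧ l₁ = l₂) ∨ (σ l₁ = l₂ ∧ τ l₂ = l₁))
    (hX : IsOrbitDominant d v ε θ₁ (σ, ξ)) (hY : IsOrbitDominant d v ε θ₂ (τ, υ))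
    (hX' : termSign ε (σ, fun l => if l = l₁ then υ l₂ else ξ l) ≠ 0)
    (hX'o : ((σ, fun l => if l = l₁ then υ l₂ else ξ l) : Equiv.Perm (Fin m) × (Fin m → Fin K)) ≠ transposeTerm (σ, ξ))
    (hY' : termSign ε (τ, fun l => if l = l₂ then ξ l₁ else υ l) ≠ 0)
    (hY'o : ((τ, fun l => if l = l₂ then ξ l₁ else υ l) : Equiv.Perm (Fin m) × (Fin m → Fin K)) ≠ transposeTerm (τ, υ))
    (hxy : ξ l₁ ≠ υ l₂) : d (ξ l₁) < d (υ l₂) := by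
  have hX'ne : ((σ, fun l => if l = l₁ then υ l₂ else ξ l) : Equiv.Perm (Fin m) × (Fin m → Fin K)) ≠ (σ, ξ) := by
    intro h
    have := congrFun (congrArg Prod.snd h) l₁
    simp only [if_true] at this
    exact hxy this.symm
  have hY'ne : ((τ, fun l => if l = l₂ then ξ l₁ else υ l) : Equiv.Perm (Fin m) × (Fin m → Fin K)) ≠ (τ, υ) := by
    intro h
    have := congrFun (congrArg Prod.snd h) l₂
    simp only [if_true] at this
    exact hxy this
  have hcellv : v (σ l₁) l₁ (υ l₂) = v (τ l₂) l₂ (υ l₂) ∧ v (τ l₂) l₂ (ξ l₁) = v (σ l₁) l₁ (ξ l₁) := by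
    rcases hcell with ⟨h1, h2⟩ | ⟨h1, h2⟩
    · subst h2; rw [h1]; exact ⟨rfl, rfl⟩
    · rw [h1, h2]; exact ⟨hv _ _ _, hv _ _ _⟩
  have ea1 := sum_apply_replace (fun _ c => (d c : ℤ)) ξ l₁ (υ l₂)
  have ea2 := sum_apply_replace (fun _ c => (d c : ℤ)) υ l₂ (ξ l₁)
  have ec1 := sum_apply_replace (fun l c => v (σ l) l c) ξ l₁ (υ l₂)
  have ec2 := sum_apply_replace (fun l c => v (τ l) l c) υ l₂ (ξ l₁)
  have h := orbit_exchange d v ε hθ (σ, ξ) (τ, υ)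
    (σ, fun l => if l = l₁ then υ l₂ else ξ l) (τ, fun l => if l = l₂ then ξ l₁ else υ l)
    hX hY hX'ne hX'o hX' hY'ne hY'o hY' (by simp only; rw [ea1, ea2]; ring)
    (by simp only; rw [ec1, ec2, hcellv.1, hcellv.2]; ring)
  rw [ea1] at h
  have : (d (ξ l₁) : ℤ) < d (υ l₂) := by linarith
  exact_mod_cast this

end Summit.ValiantsHypothesis.ValiantsHypothesis.Theorems.LacunarySymmetroidMatrixDescartes.TropicalCensus.Orbit
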